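import Summits.AtomisticToContinuum.HydrodynamicLimit.Theses.ImplosionDichotomy
import Literature.MathematicalPhysics.KineticTheory.HardSphereEulerDim

/-!
# `DenseExcursion` without its admissibility tie is TRUE (load-bearing analysis)

Negative knowledge for the crux `ImplosionDichotomy.DenseExcursion` (stmt-AtomisticToContinuum-12586), from the
standing disprover's `Cruxes/DenseExcursion/Disproof.lean` §6: `DenseExcursionUntied` is the crux VERBATIM with the
`t = 0` law-of-large-numbers tie `∀ Φ, TendstoHydroFieldsAt (localGibbsLaw …) Φ ρ u θ 0` deleted, and it HOLDS — the
constant state of density `σ⁻³` (velocity `0`, temperature `1`) is a classical hard-sphere-Euler solution for every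
`σ` (all derivatives vanish, whatever the equation of state) and has packing `1`. Hence ANY DISPROOF of the crux
(equivalently any proof of `DiluteSelfConsistency`) must work through the tie, i.e. through the pinned initial data.
refuter-cdisprove-stmt-AtomisticToContinuum-12586-g2-0.
-/

noncomputable section

namespace Summit.AtomisticToContinuum.HydrodynamicLimit.Theorems

open Set
open Literature.MathematicalPhysics.KineticTheory

/-- The crux `DenseExcursion` with the ADMISSIBILITY TIE deleted (all else verbatim). -/
def DenseExcursionUntied : Prop :=
  ∃ η : ℝ, 0 < η ∧ ∃ (a₀ θ₀ : T3 → ℝ) (u₀ : T3 → V3), Continuous a₀ ∧ Continuous θ₀ ∧ Continuous u₀ ∧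
    (∀ x, 0 < a₀ x) ∧ (∀ x, 0 < θ₀ x) ∧ ∀ σ₀ : ℝ, 0 < σ₀ → ∃ σ : ℝ, 0 < σ ∧ σ < σ₀ ∧
      ∃ (T : ℝ) (ρ θ : ℝ → T3 → ℝ) (u : ℝ → T3 → V3), IsHardSphereEulerSolution σ T ρ u θ ∧
        ∃ t ∈ Ico 0 T, ∃ x, η ≤ ρ t x * σ ^ 3

namespace DenseExcursionUntied

/-- Constant states are classical hard-sphere-Euler solutions for every `σ` and every density level. [folklore] -/
theorem isHardSphereEulerSolution_const (σ T : ℝ) {ρ₀ θ₀ : ℝ} (u₀ : V3) (hρ : 0 < ρ₀) (hθ : 0 < θ₀) :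
    IsHardSphereEulerSolution σ T (fun _ _ => ρ₀) (fun _ _ => u₀) (fun _ _ => θ₀) :=
  isHardSphereEulerSolutionDim_three_iff.1 (IsHardSphereEulerSolutionDim.const σ T u₀ hρ hθ)

end DenseExcursionUntied

open DenseExcursionUntied in
/-- THE TIE IS LOAD-BEARING: without admissibility the crux holds, witnessed by the constant state of density
`(σ₀/2)⁻³` at `σ = σ₀/2` (packing exactly `1 = η`). [folklore] -/
theorem denseExcursionUntied_holds : DenseExcursionUntied := by
  refine ⟨1, one_pos, fun _ => 1, fun _ => 1, fun _ => 0, continuous_const, continuous_const,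
    continuous_const, fun _ => one_pos, fun _ => one_pos, fun σ₀ hσ₀ => ?_⟩
  have hσ : 0 < σ₀ / 2 := by positivity
  refine ⟨σ₀ / 2, hσ, by linarith, 1, fun _ _ => ((σ₀ / 2) ^ 3)⁻¹, fun _ _ => 1, fun _ _ => 0,
    isHardSphereEulerSolution_const _ 1 0 (inv_pos.2 (pow_pos hσ 3)) one_pos, 0,
    ⟨le_rfl, one_pos⟩, 0, ?_⟩
  rw [inv_mul_cancel₀ (pow_pos hσ 3).ne']

end Summit.AtomisticToContinuum.HydrodynamicLimit.Theorems

end
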